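import Literature.Computability.Complexity.BooleanFourier
import HarnessLib

/-!
# Fourier analysis of long-code tables: coefficients over a finite label set, shifts, folding

Infrastructure for Håstad's 3-bit PCPs (Håstad, *Some optimal inapproximability results*, J. ACM 48
(2001), §2.4–2.6): a *long code* table over a finite label set `ι` is a function on the cube
`{0,1}^ι` (Håstad writes `{-1,1}^U`, `-1` = true), read in `±1` through `sgn` (`sgn true = -1`,
`Literature.Probability.RandomGraphs.LowDegree.sgn`), and its analysis is the Fourier–Walsh
expansion over the characters `χ_S(x) = ∏_{i ∈ S} (-1)^{x i}`
(`Literature.Probability.RandomGraphs.LowDegree.walsh`, general finite index type).  This file is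
the general-index-type version of the tree's `BooleanFourier.lean` (which is stated over `Fin m`
only, see its module docstring) together with the two facts about tables Håstad's tests use:

* `coeff g S = ĝ(S) = 2^{-|ι|} ∑_x g(x) χ_S(x)` for `g : (ι → Bool) → ℝ` over any finite `ι`
  (labels of a label-cover vertex are assignments, tuples, …, not literally `Fin m`);
  orthogonality summed over points (`sum_walsh_mul_walsh_pts`), inversion (`sum_coeff_mul_walsh`),
  Parseval (`sum_coeff_sq`), `∑_x χ_S(x) = 2^{|ι|} [S = ∅]` (`sum_walsh`), `|ĝ(S)| ≤ 1` for `|g| ≤ 1`,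
  and `∑_S ĝ(S)² = 1` for `±1`-valued `g` (O'Donnell 2014, §1.2–1.4);
* shifts `shift g m = g ⊕ m` (coordinatewise XOR): `χ_S(g ⊕ m) = χ_S(g) χ_S(m)`, translation
  invariance, and the **autocorrelation identity** `∑_g G(g) G(g ⊕ m) = 2^{|ι|} ∑_S Ĝ(S)² χ_S(m)`
  (the step "`E[χ_{β₁}(g₁) χ_{β₂}(g₁)] = [β₁ = β₂]`", Håstad 2001, Lemma 2.29 / eq. (35));
* **folding** (Håstad 2001, §2.5, Def. 2.30–Lemma 2.32): a table accessed "folded over true"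
  is odd, `A(¬f) = ¬A(f)`; for an odd real table `G(¬x) = -G(x)` every coefficient on a set of
  even size vanishes (`coeff_eq_zero_of_isOdd`), in particular `Ĝ(∅) = 0`, so every `S` with
  `Ĝ(S) ≠ 0` is nonempty (Lemma 2.32);
* fibre sizes `sFib β π x = #{y ∈ β | π y = x}` of a projection `π : κ → ι` (Håstad's `s_x`, §6).

Everything is a finite sum and is proved; nothing here is specific to 3-SAT.  Conditioning
(Håstad's `A_{h}`, Def. 2.33–Lemma 2.34) is not needed in the tree's label-cover formulation, where
the labels of the projected side are the satisfying assignments themselves.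

## References

* J. Håstad, *Some optimal inapproximability results*, J. ACM 48 (2001) 798–859, §2.4 (long code,
  Fourier transform, Lemma 2.29), §2.5 (folding, Lemma 2.32) [Hastad2001].
* R. O'Donnell, *Analysis of Boolean Functions*, CUP 2014, §1.2–1.4 [ODonnell2014].
-/

noncomputable section

namespace Literature.Computability.Complexity.LongCode

open Finset Literature.Probability.RandomGraphs.LowDegree

/-! ### Characters (no finiteness needed) -/

section Characters

variable {ι : Type*}

/-- `|χ_S(x)| = 1`. [folklore] -/
theorem abs_walsh (S : Finset ι) (x : ι → Bool) : |walsh S x| = 1 := by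
  unfold walsh
  rw [Finset.abs_prod]
  exact Finset.prod_eq_one fun i _ => by generalize x i = b; cases b <;> simp [sgn]

/-- `χ_S(x)² = 1`. [folklore] -/
theorem walsh_sq (S : Finset ι) (x : ι → Bool) : walsh S x ^ 2 = 1 := by
  rw [← sq_abs, abs_walsh, one_pow]

/-- `χ_S(¬x) = (-1)^{|S|} χ_S(x)`. [folklore] -/
theorem walsh_not (S : Finset ι) (x : ι → Bool) :
    walsh S (fun i => !x i) = (-1) ^ S.card * walsh S x := by
  unfold walsh
  rw [Finset.pow_card_mul_prod]
  exact prod_congr rfl fun i _ => by rcases Bool.eq_false_or_eq_true (x i) with h | h <;> simp [sgn, h]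

/-- The shift `g ⊕ m` of a point of the cube by a mask: `(g ⊕ m)(y) = g(y) XOR m(y)`; in `±1`
notation the pointwise product `g · m` (Håstad 2001, §5–6: `g₂ = f g₁ μ`). [cite: Hastad2001, §2.4] -/
def shift (g m : ι → Bool) : ι → Bool := fun y => xor (g y) (m y)

/-- Pointwise form. [folklore] -/
@[simp] theorem shift_apply (g m : ι → Bool) (y : ι) : shift g m y = xor (g y) (m y) := rfl

/-- Shifting twice by the same mask is the identity. [folklore] -/
theorem shift_shift (g m : ι → Bool) : shift (shift g m) m = g := by
  funext y
  simp only [shift]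
  generalize g y = a
  generalize m y = b
  cases a <;> cases b <;> rfl

/-- `χ_S(g ⊕ m) = χ_S(g) χ_S(m)` (characters are multiplicative). [cite: ODonnell2014, §1.2] -/
theorem walsh_shift (S : Finset ι) (g m : ι → Bool) :
    walsh S (shift g m) = walsh S g * walsh S m := by
  unfold walsh
  rw [← prod_mul_distrib]
  exact prod_congr rfl fun i _ => by
    simp only [shift_apply]
    generalize g i = a
    generalize m i = b
    cases a <;> cases b <;> simp [sgn]

/-- A real table is **odd** if `G(¬x) = -G(x)` — the `±1` reading of a table folded over true
(Håstad 2001, Def. 2.30: `A_{true}(f)` is read as `A(f)` or `-A(-f)`). [cite: Hastad2001, Def. 2.30] -/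
def IsOdd (G : (ι → Bool) → ℝ) : Prop := ∀ x : ι → Bool, G (fun i => !x i) = -G x

/-- A Boolean table is **folded (over true)** if `A(¬f) = ¬A(f)` for every `f`
(Håstad 2001, Def. 2.30–2.31). [cite: Hastad2001, Def. 2.31] -/
def IsFolded (A : (ι → Bool) → Bool) : Prop := ∀ f : ι → Bool, A (fun i => !f i) = !A f

/-- The `±1` reading of a folded table is odd. [cite: Hastad2001, Def. 2.31] -/
theorem IsFolded.isOdd_sgn {A : (ι → Bool) → Bool} (hA : IsFolded A) : IsOdd fun x => sgn (A x) := by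
  intro x
  simp only [hA x]
  cases A x <;> simp [sgn]

end Characters

/-! ### Coefficients over a finite label set -/

section Coeff

variable {ι : Type*} [Fintype ι] [DecidableEq ι]

/-- The Fourier–Walsh coefficient `ĝ(S) = 2^{-|ι|} ∑_x g(x) χ_S(x)` of a real function on the cube
`{0,1}^ι` over a finite index type (O'Donnell 2014, §1.2; Håstad 2001, §2.4, `Â_α = ⟨A, χ_α⟩`).
For `ι = Fin m` this is `LowDegree.cubeFourierCoeff` (`coeff_eq_cubeFourierCoeff`).
[cite: Hastad2001, §2.4] -/
def coeff (g : (ι → Bool) → ℝ) (S : Finset ι) : ℝ :=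
  (∑ x, g x * walsh S x) / 2 ^ Fintype.card ι

omit [Fintype ι] [DecidableEq ι] in
/-- Over `Fin m` the coefficient is the tree's `cubeFourierCoeff`. [cite: ODonnell2014, §1.2] -/
theorem coeff_eq_cubeFourierCoeff {m : ℕ} (g : (Fin m → Bool) → ℝ) (S : Finset (Fin m)) :
    coeff g S = LowDegree.cubeFourierCoeff g S := by
  simp [coeff, LowDegree.cubeFourierCoeff]

/-- `∑_x g(x) χ_S(x) = 2^{|ι|} ĝ(S)`. [cite: ODonnell2014, §1.2] -/
theorem sum_mul_walsh_eq (g : (ι → Bool) → ℝ) (S : Finset ι) :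
    ∑ x, g x * walsh S x = 2 ^ Fintype.card ι * coeff g S := by
  rw [coeff, mul_div_cancel₀ _ (by positivity)]

/-- **Fourier inversion**: `∑_S ĝ(S) χ_S(x) = g(x)` (O'Donnell 2014, Thm 1.1; Håstad 2001, §2.4).
[cite: ODonnell2014, Thm 1.1] -/
theorem sum_coeff_mul_walsh (g : (ι → Bool) → ℝ) (x : ι → Bool) :
    ∑ S, coeff g S * walsh S x = g x := by
  unfold coeff
  have h2 : (2 : ℝ) ^ Fintype.card ι ≠ 0 := by positivity
  have e1 : ∀ S : Finset ι, (∑ y, g y * walsh S y) / 2 ^ Fintype.card ι * walsh S x =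
      ∑ y, g y * (walsh S y * walsh S x) / 2 ^ Fintype.card ι := by
    intro S
    rw [Finset.sum_div, Finset.sum_mul]
    refine Finset.sum_congr rfl fun y _ => ?_
    ring
  simp_rw [e1]
  rw [Finset.sum_comm]
  have e2 : ∀ y : ι → Bool, ∑ S : Finset ι, g y * (walsh S y * walsh S x) / 2 ^ Fintype.card ι =
      g y * (∑ S : Finset ι, walsh S y * walsh S x) / 2 ^ Fintype.card ι := by
    intro y
    rw [Finset.mul_sum, Finset.sum_div]
  simp_rw [e2, sum_walsh_mul_walsh]
  simp_rw [mul_ite, mul_zero, ite_div, zero_div]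
  rw [Finset.sum_ite_eq' Finset.univ x]
  simp only [Finset.mem_univ, if_true]
  field_simp

/-- **Parseval**: `∑_S ĝ(S)² = 2^{-|ι|} ∑_x g(x)²` (O'Donnell 2014, §1.4; Håstad 2001, §2.4).
[cite: ODonnell2014, §1.4] -/
theorem sum_coeff_sq (g : (ι → Bool) → ℝ) :
    ∑ S, coeff g S ^ 2 = (∑ x, g x ^ 2) / 2 ^ Fintype.card ι := by
  unfold coeff
  set N := Fintype.card ι
  have h2 : (2 : ℝ) ^ N ≠ 0 := by positivity
  calc ∑ S : Finset ι, ((∑ x, g x * walsh S x) / 2 ^ N) ^ 2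
      = ∑ S : Finset ι, (∑ x, ∑ y, g x * g y * (walsh S x * walsh S y)) / (2 ^ N) ^ 2 := by
        refine Finset.sum_congr rfl fun S _ => ?_
        rw [div_pow, sq (∑ x, g x * walsh S x), Finset.sum_mul_sum]
        congr 1
        refine Finset.sum_congr rfl fun x _ => Finset.sum_congr rfl fun y _ => ?_
        ring
    _ = (∑ x, ∑ y, g x * g y * ∑ S : Finset ι, walsh S x * walsh S y) / (2 ^ N) ^ 2 := by
        rw [← Finset.sum_div, Finset.sum_comm]
        congr 1
        refine Finset.sum_congr rfl fun x _ => ?_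
        rw [Finset.sum_comm]
        refine Finset.sum_congr rfl fun y _ => ?_
        rw [Finset.mul_sum]
    _ = (∑ x, g x ^ 2 * 2 ^ N) / (2 ^ N) ^ 2 := by
        congr 1
        refine Finset.sum_congr rfl fun x _ => ?_
        simp_rw [sum_walsh_mul_walsh, mul_ite, mul_zero]
        rw [Finset.sum_ite_eq Finset.univ x]
        simp [sq, N]
    _ = (∑ x, g x ^ 2) / 2 ^ N := by
        rw [← Finset.sum_mul]
        field_simp

/-- `ĝ(∅) = 2^{-|ι|} ∑_x g(x)` is the mean of `g`. [cite: ODonnell2014, §1.2] -/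
theorem coeff_empty (g : (ι → Bool) → ℝ) : coeff g ∅ = (∑ x, g x) / 2 ^ Fintype.card ι := by
  simp [coeff]

/-- Coefficients of a bounded function are bounded: `|g| ≤ 1 ⇒ |ĝ(S)| ≤ 1`. [cite: ODonnell2014, §1.2] -/
theorem abs_coeff_le_one (g : (ι → Bool) → ℝ) (hg : ∀ x, |g x| ≤ 1) (S : Finset ι) :
    |coeff g S| ≤ 1 := by
  unfold coeff
  rw [abs_div, abs_of_pos (by positivity : (0 : ℝ) < 2 ^ Fintype.card ι), div_le_one (by positivity)]
  calc |∑ x, g x * walsh S x| ≤ ∑ x : ι → Bool, |g x * walsh S x| := Finset.abs_sum_le_sum_abs _ _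
    _ ≤ ∑ _x : ι → Bool, (1 : ℝ) := by
        refine Finset.sum_le_sum fun x _ => ?_
        rw [abs_mul, abs_walsh, mul_one]
        exact hg x
    _ = 2 ^ Fintype.card ι := by simp

/-- For a `±1`-valued table the Fourier weights sum to one: `∑_S ĝ(S)² = 1` when `g(x)² = 1`
(Håstad 2001, §2.4, "Parseval's identity … `∑_α Â_α² = 1`"). [cite: Hastad2001, §2.4] -/
theorem sum_coeff_sq_eq_one (g : (ι → Bool) → ℝ) (hg : ∀ x, g x ^ 2 = 1) :
    ∑ S, coeff g S ^ 2 = 1 := by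
  rw [sum_coeff_sq, Finset.sum_congr rfl fun x _ => hg x]
  simp

/-- The `±1` reading of a Boolean table has `∑_S ĝ(S)² = 1`. [cite: Hastad2001, §2.4] -/
theorem sum_coeff_sgn_sq (A : (ι → Bool) → Bool) :
    ∑ S, coeff (fun x => sgn (A x)) S ^ 2 = 1 :=
  sum_coeff_sq_eq_one _ fun x => by rw [sq, sgn_mul_self]

/-- Fourier weights are a sub-probability on any family of sets: `∑_{S ∈ 𝒮} ĝ(S)² ≤ 1` for a
`±1`-valued `g`. [cite: Hastad2001, §2.4] -/
theorem sum_coeff_sq_le_one (g : (ι → Bool) → ℝ) (hg : ∀ x, g x ^ 2 = 1) (𝒮 : Finset (Finset ι)) :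
    ∑ S ∈ 𝒮, coeff g S ^ 2 ≤ 1 := by
  rw [← sum_coeff_sq_eq_one g hg]
  exact Finset.sum_le_univ_sum_of_nonneg fun S => sq_nonneg _

/-! ### Shifts -/

/-- **Translation invariance** of uniform sums: `∑_g F(g ⊕ m) = ∑_g F(g)`. [folklore] -/
theorem sum_shift (F : (ι → Bool) → ℝ) (m : ι → Bool) : ∑ g, F (shift g m) = ∑ g, F g :=
  Fintype.sum_equiv (Equiv.ofBijective (fun g => shift g m)
    (Function.Involutive.bijective fun g => shift_shift g m)) _ _ fun _ => rfl

/-- **Autocorrelation identity**: `∑_g G(g) G(g ⊕ m) = 2^{|ι|} ∑_S Ĝ(S)² χ_S(m)` — expand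
`G(g ⊕ m)`, use `χ_S(g ⊕ m) = χ_S(g) χ_S(m)` and orthogonality in `g` (Håstad 2001, proof of
Lemma 5.2 and eq. (35): "any term with `β₁ ≠ β₂` has expected value `0`").
[cite: Hastad2001, Lemma 2.29 and eq. (35)] -/
theorem sum_mul_shift (G : (ι → Bool) → ℝ) (m : ι → Bool) :
    ∑ g, G g * G (shift g m) = 2 ^ Fintype.card ι * ∑ S, coeff G S ^ 2 * walsh S m := by
  calc ∑ g, G g * G (shift g m)
      = ∑ g, ∑ S, coeff G S * walsh S m * (G g * walsh S g) := by
        refine sum_congr rfl fun g _ => ?_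
        rw [← sum_coeff_mul_walsh G (shift g m), mul_sum]
        refine sum_congr rfl fun S _ => ?_
        rw [walsh_shift]
        ring
    _ = ∑ S, coeff G S * walsh S m * ∑ g, G g * walsh S g := by
        rw [sum_comm]
        refine sum_congr rfl fun S _ => ?_
        rw [mul_sum]
    _ = 2 ^ Fintype.card ι * ∑ S, coeff G S ^ 2 * walsh S m := by
        rw [mul_sum]
        refine sum_congr rfl fun S _ => ?_
        rw [sum_mul_walsh_eq]
        ring

/-! ### Folding -/

/-- **Håstad 2001, Lemma 2.32** (in coefficient form): an odd table has no Fourier weight on sets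
of even size, `|S|` even ⇒ `Ĝ(S) = 0`; in particular `Ĝ(∅) = 0` and every `S` with `Ĝ(S) ≠ 0`
is nonempty. [cite: Hastad2001, Lemma 2.32] -/
theorem coeff_eq_zero_of_isOdd {G : (ι → Bool) → ℝ} (hG : IsOdd G) {S : Finset ι}
    (hS : Even S.card) : coeff G S = 0 := by
  have hinv : Function.Involutive (fun x : ι → Bool => fun i => !x i) := fun x => by
    funext i; simp
  have hsum : ∑ x, G x * walsh S x = ∑ x : ι → Bool, G (fun i => !x i) * walsh S (fun i => !x i) :=
    (Fintype.sum_equiv (Equiv.ofBijective _ hinv.bijective) _ _ fun _ => rfl).symm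
  have hneg : ∑ x, G x * walsh S x = -∑ x, G x * walsh S x := by
    conv_lhs => rw [hsum]
    rw [← sum_neg_distrib]
    refine sum_congr rfl fun x _ => ?_
    rw [hG x, walsh_not, Even.neg_one_pow hS]
    ring
  have h0 : ∑ x, G x * walsh S x = 0 := by linarith
  simp [coeff, h0]

/-- An odd table has mean zero: `Ĝ(∅) = 0`. [cite: Hastad2001, Lemma 2.32] -/
theorem coeff_empty_eq_zero_of_isOdd {G : (ι → Bool) → ℝ} (hG : IsOdd G) : coeff G ∅ = 0 :=
  coeff_eq_zero_of_isOdd hG (by simp)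

/-- Nonzero coefficients of an odd table sit on nonempty sets (Håstad 2001, Lemma 2.32: "both `α`
and `β` are always nonempty"). [cite: Hastad2001, Lemma 2.32] -/
theorem nonempty_of_coeff_ne_zero {G : (ι → Bool) → ℝ} (hG : IsOdd G) {S : Finset ι}
    (hS : coeff G S ≠ 0) : S.Nonempty := by
  rw [Finset.nonempty_iff_ne_empty]
  rintro rfl
  exact hS (coeff_empty_eq_zero_of_isOdd hG)

/-- The sum of an odd table over the cube vanishes. [cite: Hastad2001, Lemma 2.32] -/
theorem sum_eq_zero_of_isOdd {G : (ι → Bool) → ℝ} (hG : IsOdd G) : ∑ x, G x = 0 := by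
  have h := coeff_empty_eq_zero_of_isOdd hG
  rw [coeff_empty, div_eq_zero_iff] at h
  exact h.resolve_right (by positivity)

end Coeff

/-! ### Orthogonality summed over points -/

section Points

variable {ι : Type*} [Fintype ι] [DecidableEq ι]

/-- A character as a product over all coordinates. [folklore] -/
theorem walsh_eq_prod_ite (S : Finset ι) (x : ι → Bool) :
    walsh S x = ∏ i, (if i ∈ S then sgn (x i) else 1) := by
  rw [walsh, ← Finset.prod_filter]; simp

/-- **Orthogonality of characters, summed over points**: `∑_x χ_S(x) χ_T(x) = 2^{|ι|} [S = T]`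
(O'Donnell 2014, §1.4; Håstad 2001, Lemma 2.29 with uniform `f`). [cite: ODonnell2014, §1.4] -/
theorem sum_walsh_mul_walsh_pts (S T : Finset ι) :
    ∑ x : ι → Bool, walsh S x * walsh T x = if S = T then (2 : ℝ) ^ Fintype.card ι else 0 := by
  have key : ∀ x : ι → Bool, walsh S x * walsh T x =
      ∏ i, ((if i ∈ S then sgn (x i) else 1) * (if i ∈ T then sgn (x i) else 1)) := by
    intro x
    rw [walsh_eq_prod_ite, walsh_eq_prod_ite, ← Finset.prod_mul_distrib]
  simp_rw [key]
  rw [← Fintype.prod_sum fun i b => (if i ∈ S then sgn b else (1 : ℝ)) * (if i ∈ T then sgn b else 1)]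
  by_cases hST : S = T
  · subst hST
    rw [if_pos rfl, Finset.prod_congr rfl (g := fun _ => (2 : ℝ)), Finset.prod_const, Finset.card_univ]
    intro i _
    by_cases hi : i ∈ S <;> simp [hi]
  · rw [if_neg hST]
    obtain ⟨i, hi⟩ : ∃ i, ¬ (i ∈ S ↔ i ∈ T) := by
      by_contra h
      push Not at h
      exact hST (Finset.ext h)
    apply Finset.prod_eq_zero (Finset.mem_univ i)
    by_cases hiS : i ∈ S
    · have hiT : i ∉ T := fun hiT => hi ⟨fun _ => hiT, fun _ => hiS⟩
      simp [hiS, hiT, sgn]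
    · have hiT : i ∈ T := by
        by_contra hiT; exact hi ⟨fun h => absurd h hiS, fun h => absurd h hiT⟩
      simp [hiS, hiT, sgn]

/-- `∑_x χ_S(x) = 2^{|ι|} [S = ∅]` (the case `T = ∅`). [cite: ODonnell2014, §1.4] -/
theorem sum_walsh (S : Finset ι) :
    ∑ x : ι → Bool, walsh S x = if S = ∅ then (2 : ℝ) ^ Fintype.card ι else 0 := by
  have h := sum_walsh_mul_walsh_pts S ∅
  simpa using h

end Points

/-! ### Fibres of a projection -/

section Fibres

variable {ι κ : Type*} [DecidableEq ι]

/-- The fibre size `s_x = #{y ∈ β | π y = x}` of a set `β` of labels over the point `x` under the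
projection `π` (Håstad 2001, §6: "for `x ∈ π(β)` let `s_x` denote the number of elements of `β`
that project onto `x`"). [cite: Hastad2001, §6 (eq. (36))] -/
def sFib (β : Finset κ) (π : κ → ι) (x : ι) : ℕ := (β.filter fun y => π y = x).card

/-- `s_x ≥ 1` exactly for `x ∈ π(β)`. [cite: Hastad2001, §6] -/
theorem sFib_pos_iff (β : Finset κ) (π : κ → ι) (x : ι) :
    0 < sFib β π x ↔ x ∈ β.image π := by
  rw [sFib, Finset.card_pos, Finset.mem_image]
  constructor
  · rintro ⟨y, hy⟩
    exact ⟨y, (Finset.mem_filter.1 hy).1, (Finset.mem_filter.1 hy).2⟩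
  · rintro ⟨y, hy, rfl⟩
    exact ⟨y, Finset.mem_filter.2 ⟨hy, rfl⟩⟩

/-- `s_x = 0` off `π(β)`. [cite: Hastad2001, §6] -/
theorem sFib_eq_zero (β : Finset κ) (π : κ → ι) {x : ι} (hx : x ∉ β.image π) :
    sFib β π x = 0 := by
  by_contra h
  exact hx ((sFib_pos_iff β π x).1 (Nat.pos_of_ne_zero h))

/-- `∑_{x ∈ π(β)} s_x = |β|`. [cite: Hastad2001, §6] -/
theorem sum_sFib (β : Finset κ) (π : κ → ι) :
    ∑ x ∈ β.image π, sFib β π x = β.card := by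
  unfold sFib
  rw [← Finset.card_eq_sum_card_image]

/-- A product over `β` of a function of `π y` is a product over `π(β)` of powers `s_x`.
[cite: Hastad2001, §6 (eq. (36))] -/
theorem prod_comp_eq_prod_pow (β : Finset κ) (π : κ → ι) (h : ι → ℝ) :
    ∏ y ∈ β, h (π y) = ∏ x ∈ β.image π, h x ^ sFib β π x :=
  Finset.prod_comp h π

end Fibres

end Literature.Computability.Complexity.LongCode

end
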